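import Summits.BirchSwinnertonDyer.BirchSwinnertonDyer.Theorems.SignedLowerHalvesKobayashiLowerHalfLargeImageCongruenceRecords11
import Summits.BirchSwinnertonDyer.BirchSwinnertonDyer.Theorems.SignedLowerHalvesKobayashiLowerHalfLargeImageCongruencePlacesGood
import Summits.BirchSwinnertonDyer.Rank1Residual.Supersingular.X7SevenCongruenceCertificates
import Summits.BirchSwinnertonDyer.Rank1Residual.Supersingular.RankOneSurjCertificatesX7_14
import HarnessLib

/-!
# Route `SignedLowerHalves`, crux `KobayashiLowerHalfLargeImage` (item stmt-BirchSwinnertonDyer-19001):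
# congruence-road RECORDS AT p = 7, part 4 — `congl7_134420g1_7` (`ε = −1`) from the RANK-ONE DONOR `2068c1`
# (cell `bsd-ssimc`, seat `bsd-ssimc-k3-c3` gen 10, object «CONG7-ROAD»; shapes of the `p = 5` records `…CongruenceFiveRecords*`
# (g9) with the mod-7 congruence certified in the kernel through x10b's `sevenCongruent_of_twistCertificate7`;
# `--supports stmt-BirchSwinnertonDyer-19001 --as helper`; closes nothing about the crux)

PARTITION (cell bsd-ssimc): X7 (A7) × the pair `(134420g1, 7)` — Cremona `[0, 1, 0, -342100, 86102500]`, `N = 134420 = 2²·5·11·13·47`, `r_an = 1`,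
`ρ̄_{E,7}` onto (kernel certificate `surj_x7r1_134420g1_7`), `a_7 = 0`, not semistable; **a LIVE RESIDUE cell `(7, X7)` on desk A's newest state
`pub-bsdpct-r1-g257/scratchA_A_state_after_hyb3_x4g_v6v7_fold.pkl` — the class's ONLY open cell, registers none** — whose two-engine Mazur–Tate colour is NOT tight
(`λ(L⁻¹_7) = 3 > r_an`, no MT-road record possible) — closes PER PAIR: `KobayashiMainConjecture W 7 (−1)`, item 3's
`∃ ε, KobayashiLowerDivisibility W 7 ε` and (BSD file) `BSDp W 7`, from PUBLISHED inputs by name (incl. Fisher 2014 Thm 4.8 `hF` applied to a kernel-checked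
rational point of the twisted Klein quartic `X(7)`) + E's displayed two-engine row + kernel-decided Greenberg–Vatsal/Kim bookkeeping + the donor's rank datum;
crux OPEN; nothing booked (the OFFER is the planner's); BSD is not proved by any of this. THEOREMS ONLY.

ROAD (`…CongruenceShapeBound` p481588 §1 + (D1)/(D1′), at `p = 7`): Kato `ξ ∣ L^ε_7(E)` (Kobayashi Thm 4.1, integral under Surj) gives
`λ(ξ) ≤ λ(L)`; B. D. Kim 2009 Cor. 2.13 along the `7`-congruence `E[7] ≅ E′[7]` gives `λ(X^ε(E)) + Σδ_E = λ(X^ε(E′)) + Σδ_{E′}`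
(`μ = 0` from E's certificate); the donor supplies `λ(X^ε(E′)) ≥ rank E′(ℚ)` (Kummer points in `Sel^ε`); the books close the
squeeze `λ(X^ε(E)) ≥ λ(L^ε_7(E))` ⇒ `(ξ) = (ϖ L^ε_7)`. Donor = g9's mod-7 trace scan of the Cremona database (kit j268296); the rational point of
`X(7)` found exactly by resultants (this seat, kit j274071 in Halberstadt–Kraus coordinates, j274308 in Fisher's Thm 3.9 coordinates — the tree's); every δ
and the five certificate identities re-decided here by the kernel.

References: [Kobayashi2003] Conj. (p. 2), Thm. 1.2, 4.1, 7.4; [BDKim2009] Cor. 2.13, 2.5, Prop. 2.6; [GreenbergLNM1716] §3;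
[Pollack2003] Def. 6.15, Prop. 6.9/6.10/6.18; [Fisher2014SevenElevenCongruent] Thm. 3.9, 4.6, 4.8; [GreenbergVatsal2000] Prop. (2.4);
[BurungaleKobayashiOta2023] Cor. A.5; [Cremona2006] Table 1.
-/

set_option autoImplicit false
set_option linter.dupNamespace false
noncomputable section

open scoped Classical MatrixGroups ModularForm BigOperators

open CongruenceSubgroup WeierstrassCurve NumberField IsDedekindDomain Rat.HeightOneSpectrum
  Literature.NumberTheory.EllipticCurves
  Literature.NumberTheory.EllipticCurves.ModularForms
  Literature.NumberTheory.EllipticCurves.Rank1Residual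
  Literature.NumberTheory.EllipticCurves.Rank1Residual.Typed
  Literature.NumberTheory.EllipticCurves.Kobayashi2003 ZpExtension
  Literature.NumberTheory.EllipticCurves.GreenbergVatsal2000
  Literature.NumberTheory.EllipticCurves.BurungaleKobayashiOta2024
  Literature.NumberTheory.EllipticCurves.Fisher2014
  Literature.NumberTheory.EllipticCurves.Rank1Residual.X11RankOneCertificates
  Literature.NumberTheory.GaloisRepresentations
  Summit.BirchSwinnertonDyer.Rank1Residual.X1.MuLambda
  Summit.BirchSwinnertonDyer.Rank1Residual.Supersingular
  Summit.BirchSwinnertonDyer.Rank1Residual.X2.LocalDeltaCalculus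
  Summit.BirchSwinnertonDyer.BirchSwinnertonDyer.Rank1Residual.IntModel
  Summit.BirchSwinnertonDyer.BirchSwinnertonDyer.Rank1Residual.X11RankOne
  Summit.BirchSwinnertonDyer.Rank1Residual.X11b

namespace Summit.BirchSwinnertonDyer.BirchSwinnertonDyer.Theorems.CongruenceRoad

/-! ### §1 The data of the pair `(134420g1, 7)` and its donor `2068c1` -/

/-- `#Ẽ(𝔽_7) = 8` for `134420g1` (`a_7 = 0`). [cite: Cremona2006, Table 1 (Cremona label 134420g1)] -/
theorem s4_countPoints_134420g1_7 : countPoints [0, 1, 0, -342100, 86102500] 7 = (8 : ℕ) :=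
  countPoints_eq_of_fast (by decide +kernel)

/-- `#Ẽ′(𝔽_7) = 8` for the donor `2068c1` `[0, 1, 0, -9581, -364177]` (`a_7 = 0`). [cite: Cremona2006, Table 1 (Cremona label 2068c1)] -/
theorem s4_countPoints_2068c1_7 : countPoints [0, 1, 0, -9581, -364177] 7 = (8 : ℕ) :=
  countPoints_eq_of_fast (by decide +kernel)

/-- `#(𝔽_{5})`-points of the reduction of `2068c1` `[0, 1, 0, -9581, -364177]` (good at `5`): `7` (`7 ∣ 7`). [cite: Cremona2006, Table 1 (Cremona label 2068c1)] -/
theorem s4_countPoints_2068c1_5 : countPoints [0, 1, 0, -9581, -364177] 5 = (7 : ℕ) :=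
  countPoints_eq_of_fast (by decide +kernel)

/-- `#(𝔽_{13})`-points of the reduction of `2068c1` `[0, 1, 0, -9581, -364177]` (good at `13`): `14` (`7 ∣ 14`). [cite: Cremona2006, Table 1 (Cremona label 2068c1)] -/
theorem s4_countPoints_2068c1_13 : countPoints [0, 1, 0, -9581, -364177] 13 = (14 : ℕ) :=
  countPoints_eq_of_fast (by decide +kernel)

/-! ### §2 The lower-bound road at the pair, sign-generic -/

/-- **The LOWER-BOUND congruence road AT THE PAIR `(134420g1, 7)`, sign-generic** (shape of records 10/11 p484912/p484984 and of the
`p = 5` records `…CongruenceFiveRecords*`, now at `p = 7`). Target `E = [0, 1, 0, -342100, 86102500]` (Cremona 134420g1, `N = 134420 = 2²·5·11·13·47`, X7, `r_an = 1`;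
`Surj E 7` is the landed certificate `surj_x7r1_134420g1_7` BY NAME), donor `E′ = [0, 1, 0, -9581, -364177]` (Cremona 2068c1, `N′ = 2068 = 2²·11·47`),
`7`-congruent to `E`: `E` is the `u`-scaling (`u = 79152463872/5`) of the member `E_P` of Fisher's family (4.8) at the rational point `P = (-1133968 : 1676 : 15)` of `X_{E′}(7)` (the twisted Klein quartic `𝓕` of Fisher 2014 Thm 3.9 written for the Cremona model of `E′`) — `sevenCongruent_of_twistCertificate7` (x10b, `X7SevenCongruenceCertificates.lean`): `𝓕(P) = 0`,
`d₁(P) ≠ 0`, `H(𝓕)(P) ≠ 0`, `c₄(𝓕)(P) = u⁴·c₄·d₁(P)²`, `c₆(𝓕)(P) = u⁶·c₆·d₁(P)³` KERNEL-checked (`decide +kernel`), the congruence itself the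
PUBLISHED named fact `hF` = Fisher 2014 Thm 4.8 (`thm48_sevenCongruent_twistQuartic7`); pair found by the g9 mod-7 trace scan of the Cremona database
(kit j268296, congruent at every good prime < 2000; re-checked < 400 in kit j274308) and the point solved exactly (resultant + rational roots,
kit j274071 / j274308); `E′` good supersingular at `7` with `a_7(E′) = 0`. For ANY sign `ε` and ANY `l, l′`: GIVEN E's certificate read-out
`hcert : (μ, λ)(L^ε_7(E)) = (0, l)`, a LOWER bound `hlam′ : l′ ≤ λ(X^ε(E′))` on every dual datum, and the books `l + 0 ≤ l′ + 2`
(`Σ₀ = {2, 5, 11, 13, 47}`, `δ_E = (0, 0, 0, 0, 0)`, `δ_{E′} = (0, 1, 0, 1, 0)` at `p = 7`: `s_ℓ` from `ℓ⁶ − 1 = 7^{k+1} m`; every δ KERNEL-DECIDED by the place toolkit), the tree's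
`kobayashiMainConjecture_of_lambdaTransfer_of_le_at_conductor` (p481588) gives `KobayashiMainConjecture E 7 ε`. Published inputs BY NAME
(`h12 h41 h5 h3 hL20 hKim hF`); data binders: the minimality/ellipticity instances of both literal models, `NeZero N_E`, `f₀`. PER PAIR;
closes nothing by itself. [cite: Kobayashi2003, Conjecture (p. 2), Thm. 1.2 and Thm. 4.1] [cite: BDKim2009, Cor. 2.13, Cor. 2.5 and Prop. 2.6 (pp. 185–187)]
[cite: Fisher2014SevenElevenCongruent, Thm. 4.8 with Thm. 4.6 and Thm. 3.9] [cite: GreenbergVatsal2000, §2 Prop. (2.4)] [cite: Cremona2006, Table 1 (Cremona label 134420g1)] -/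
theorem congl7_kobayashiMainConjecture_134420g1_7_of_partnerBound_2068c1
    (h12 : Kobayashi2003.thm12_signedSelmerDual_finite_torsion)
    (h41 : Kobayashi2003.thm41_signedCharIdeal_divisibility)
    (h5 : realPeriodRat_eq_unit_mul_plusPeriod) (h3 : realPeriodRat_eq_unit_mul_plusPeriod_three)
    (hL20 : Wuthrich2014.lemma20_surjective_threeAdic_of_semistable)
    (hKim : BDKim2009.cor213_signedLambda_add_sum_delta_eq_of_torsionIso)
    (hF : thm48_sevenCongruent_twistQuartic7)
    [(⟨0, 1, 0, -342100, 86102500⟩ : WeierstrassCurve ℚ).IsElliptic]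
    [(⟨0, 1, 0, -342100, 86102500⟩ : WeierstrassCurve ℚ).IsGloballyMinimal]
    [(⟨0, 1, 0, -9581, -364177⟩ : WeierstrassCurve ℚ).IsElliptic]
    [(⟨0, 1, 0, -9581, -364177⟩ : WeierstrassCurve ℚ).IsGloballyMinimal]
    [NeZero ((⟨0, 1, 0, -342100, 86102500⟩ : WeierstrassCurve ℚ).conductorNorm ℤ)]
    {f₀ : CuspForm (Gamma0 ((⟨0, 1, 0, -342100, 86102500⟩ : WeierstrassCurve ℚ).conductorNorm ℤ)) 2}
    (hf₀ : IsNewformOf (⟨0, 1, 0, -342100, 86102500⟩ : WeierstrassCurve ℚ) f₀)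
    (ε : ℤˣ) {l l' : ℕ}
    (hcert : ∀ L : IwasawaAlgebra 7, IsSignedPAdicLFunction f₀ 7 ε L → mu L = 0 ∧ lam L = l)
    (hlam' : ∀ (κ : ZpExtension ℚ 7) (γ : Field.absoluteGaloisGroup ℚ), κ.IsCyclotomic →
      κ.IsTopGenerator γ → IsCyclotomicVariable 7 γ →
      ∀ (D' : SignedSelmerDualData (⟨0, 1, 0, -9581, -364177⟩ : WeierstrassCurve ℚ) κ γ ε)
      [Module.Finite (IwasawaAlgebra 7) D'.X], Module.IsTorsion (IwasawaAlgebra 7) D'.X →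
      l' ≤ lambdaInvariant 7 D'.X)
    (hll : l + 0 ≤ l' + 2) :
    KobayashiMainConjecture (⟨0, 1, 0, -342100, 86102500⟩ : WeierstrassCurve ℚ) 7 ε := by
  have hI : integralModelInt (⟨0, 1, 0, -342100, 86102500⟩ : WeierstrassCurve ℚ) = ⟨0, 1, 0, -342100, 86102500⟩ :=
    integralModelInt_eq_of_map_eq _ (map_mk_int 0 1 0 (-342100) 86102500)
  have hp2 : (7 : ℕ) ≠ 2 := by decide
  have hn := natCard_point_eq_of_countPoints 0 1 0 (-342100) 86102500 7 hp2 (by decide) s4_countPoints_134420g1_7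
  have hSS : GoodSS (⟨0, 1, 0, -342100, 86102500⟩ : WeierstrassCurve ℚ) 7 :=
    goodSS_of_intModel 7 hI (by decide) hn (by norm_num)
  have hap : (⟨0, 1, 0, -342100, 86102500⟩ : WeierstrassCurve ℚ).frobeniusTrace 7 = 0 := by
    rw [frobeniusTrace_eq hI hn]; norm_num
  have hI' : integralModelInt (⟨0, 1, 0, -9581, -364177⟩ : WeierstrassCurve ℚ) = ⟨0, 1, 0, -9581, -364177⟩ :=
    integralModelInt_eq_of_map_eq _ (map_mk_int 0 1 0 (-9581) (-364177))
  have hn' := natCard_point_eq_of_countPoints 0 1 0 (-9581) (-364177) 7 hp2 (by decide) s4_countPoints_2068c1_7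
  have hSS' : GoodSS (⟨0, 1, 0, -9581, -364177⟩ : WeierstrassCurve ℚ) 7 :=
    goodSS_of_intModel 7 hI' (by decide) hn' (by norm_num)
  have hap' : (⟨0, 1, 0, -9581, -364177⟩ : WeierstrassCurve ℚ).frobeniusTrace 7 = 0 := by
    rw [frobeniusTrace_eq hI' hn']; norm_num
  have hs : Surj (⟨0, 1, 0, -342100, 86102500⟩ : WeierstrassCurve ℚ) 7 := surj_x7r1_134420g1_7
  -- the 7-congruence: `E` is the `u`-scaling of the member `E_P` of Fisher's family (4.8) at the rational point
  -- `P = (-1133968 : 1676 : 15)` of the twisted Klein quartic `X_{E′}(7) = {𝓕 = 0}` (Thm 3.9 coordinates of `E′`), `u = 79152463872/5`;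
  -- the five rational identities/non-vanishings are kernel-checked (`decide +kernel`, x10b's evaluator), the congruence itself is the named fact `hF`
  have he : ∃ e : geomTorsion (⟨0, 1, 0, -342100, 86102500⟩ : WeierstrassCurve ℚ) ((7 : ℕ) : ℤ) ≃+
      geomTorsion (⟨0, 1, 0, -9581, -364177⟩ : WeierstrassCurve ℚ) ((7 : ℕ) : ℤ),
      ∀ (σ : Field.absoluteGaloisGroup ℚ) (P : geomTorsion (⟨0, 1, 0, -342100, 86102500⟩ : WeierstrassCurve ℚ)
        ((7 : ℕ) : ℤ)), e (σ • P) = σ • e P :=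
    sevenCongruent_of_twistCertificate7 hF (⟨0, 1, 0, -9581, -364177⟩ : WeierstrassCurve ℚ)
      (⟨0, 1, 0, -342100, 86102500⟩ : WeierstrassCurve ℚ) 459904 311889536 16420816 (-74491084864)
      (-1133968) 1676 15 (79152463872 / 5) (by norm_num [WeierstrassCurve.c₄, WeierstrassCurve.b₂, WeierstrassCurve.b₄]) (by norm_num [WeierstrassCurve.c₆, WeierstrassCurve.b₂, WeierstrassCurve.b₄, WeierstrassCurve.b₆])
      (by norm_num [WeierstrassCurve.c₄, WeierstrassCurve.b₂, WeierstrassCurve.b₄]) (by norm_num [WeierstrassCurve.c₆, WeierstrassCurve.b₂, WeierstrassCurve.b₄, WeierstrassCurve.b₆]) (by norm_num) (by norm_num) (by norm_num)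
      (by decide +kernel) (by decide +kernel) (by decide +kernel) (by decide +kernel) (by decide +kernel)
  -- the places of `Σ₀ = {2, 5, 11, 13, 47}`
  set v2 : HeightOneSpectrum (𝓞 ℚ) := (primesEquiv (R := 𝓞 ℚ)).symm ⟨2, Nat.prime_two⟩ with hv2
  set v5 : HeightOneSpectrum (𝓞 ℚ) := (primesEquiv (R := 𝓞 ℚ)).symm ⟨5, (by norm_num)⟩ with hv5
  set v11 : HeightOneSpectrum (𝓞 ℚ) := (primesEquiv (R := 𝓞 ℚ)).symm ⟨11, (by norm_num)⟩ with hv11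
  set v13 : HeightOneSpectrum (𝓞 ℚ) := (primesEquiv (R := 𝓞 ℚ)).symm ⟨13, (by norm_num)⟩ with hv13
  set v47 : HeightOneSpectrum (𝓞 ℚ) := (primesEquiv (R := 𝓞 ℚ)).symm ⟨47, (by norm_num)⟩ with hv47
  -- δ-terms of `E`
  have d2 : delta (⟨0, 1, 0, -342100, 86102500⟩ : WeierstrassCurve ℚ) 7 v2 = 0 :=
    delta_eq_zero_of_dvd_of_dvd hI 7 v2 (by rw [hv2, natGenerator_symm]; decide)
      (by rw [hv2, natGenerator_symm]; decide)
  have d5 : delta (⟨0, 1, 0, -342100, 86102500⟩ : WeierstrassCurve ℚ) 7 v5 = 0 := by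
    rw [delta_eq_of_split hI 7 v5 5 (by norm_num) (by rw [hv5, natGenerator_symm]) (by decide) (by decide)
      ⟨1, by decide +kernel⟩, sFactor_eq_of_eq_pow_mul (k := 0) (m := 2232) (by norm_num) (by norm_num)]
    decide
  have d11 : delta (⟨0, 1, 0, -342100, 86102500⟩ : WeierstrassCurve ℚ) 7 v11 = 0 := by
    rw [delta_eq_of_split hI 7 v11 11 (by norm_num) (by rw [hv11, natGenerator_symm]) (by decide) (by decide)
      ⟨1, by decide +kernel⟩, sFactor_eq_of_eq_pow_mul (k := 0) (m := 253080) (by norm_num) (by norm_num)]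
    decide
  have d13 : delta (⟨0, 1, 0, -342100, 86102500⟩ : WeierstrassCurve ℚ) 7 v13 = 0 := by
    rw [delta_eq_of_split hI 7 v13 13 (by norm_num) (by rw [hv13, natGenerator_symm]) (by decide) (by decide)
      ⟨2, by decide +kernel⟩, sFactor_eq_of_eq_pow_mul (k := 0) (m := 689544) (by norm_num) (by norm_num)]
    decide
  have d47 : delta (⟨0, 1, 0, -342100, 86102500⟩ : WeierstrassCurve ℚ) 7 v47 = 0 := by
    rw [delta_eq_of_nonsplit hI 7 v47 47 (by norm_num) (by rw [hv47, natGenerator_symm]) (by decide) (by decide)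
      (by decide +kernel), sFactor_eq_of_eq_pow_mul (k := 0) (m := 1539887904) (by norm_num) (by norm_num)]
    decide
  -- δ-terms of `E′`
  have e2 : delta (⟨0, 1, 0, -9581, -364177⟩ : WeierstrassCurve ℚ) 7 v2 = 0 :=
    delta_eq_zero_of_dvd_of_dvd hI' 7 v2 (by rw [hv2, natGenerator_symm]; decide)
      (by rw [hv2, natGenerator_symm]; decide)
  have e5 : delta (⟨0, 1, 0, -9581, -364177⟩ : WeierstrassCurve ℚ) 7 v5 = 1 := by
    rw [delta_eq_of_good_of_dvd_count hI' 7 v5 5 (by norm_num) (by rw [hv5, natGenerator_symm]) (by norm_num)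
      (by norm_num) rfl (by decide) s4_countPoints_2068c1_5 (by decide),
      sFactor_eq_of_eq_pow_mul (k := 0) (m := 2232) (by norm_num) (by norm_num)]
    decide
  have e11 : delta (⟨0, 1, 0, -9581, -364177⟩ : WeierstrassCurve ℚ) 7 v11 = 0 := by
    rw [delta_eq_of_split hI' 7 v11 11 (by norm_num) (by rw [hv11, natGenerator_symm]) (by decide) (by decide)
      ⟨1, by decide +kernel⟩, sFactor_eq_of_eq_pow_mul (k := 0) (m := 253080) (by norm_num) (by norm_num)]
    decide
  have e13 : delta (⟨0, 1, 0, -9581, -364177⟩ : WeierstrassCurve ℚ) 7 v13 = 1 := by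
    rw [delta_eq_of_good_of_dvd_count hI' 7 v13 13 (by norm_num) (by rw [hv13, natGenerator_symm]) (by norm_num)
      (by norm_num) rfl (by decide) s4_countPoints_2068c1_13 (by decide),
      sFactor_eq_of_eq_pow_mul (k := 0) (m := 689544) (by norm_num) (by norm_num)]
    decide
  have e47 : delta (⟨0, 1, 0, -9581, -364177⟩ : WeierstrassCurve ℚ) 7 v47 = 0 := by
    rw [delta_eq_of_nonsplit hI' 7 v47 47 (by norm_num) (by rw [hv47, natGenerator_symm]) (by decide) (by decide)
      (by decide +kernel), sFactor_eq_of_eq_pow_mul (k := 0) (m := 1539887904) (by norm_num) (by norm_num)]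
    decide
  -- distinctness of the places
  have n1 : v2 ∉ ({v5, v11, v13, v47} : Finset (HeightOneSpectrum (𝓞 ℚ))) := by
    simp only [Finset.mem_insert, Finset.mem_singleton, hv2, hv5, hv11, hv13, hv47, not_or]
    exact ⟨symm_ne_symm _ _ (by norm_num), symm_ne_symm _ _ (by norm_num), symm_ne_symm _ _ (by norm_num), symm_ne_symm _ _ (by norm_num)⟩
  have n2 : v5 ∉ ({v11, v13, v47} : Finset (HeightOneSpectrum (𝓞 ℚ))) := by
    simp only [Finset.mem_insert, Finset.mem_singleton, hv5, hv11, hv13, hv47, not_or]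
    exact ⟨symm_ne_symm _ _ (by norm_num), symm_ne_symm _ _ (by norm_num), symm_ne_symm _ _ (by norm_num)⟩
  have n3 : v11 ∉ ({v13, v47} : Finset (HeightOneSpectrum (𝓞 ℚ))) := by
    simp only [Finset.mem_insert, Finset.mem_singleton, hv11, hv13, hv47, not_or]
    exact ⟨symm_ne_symm _ _ (by norm_num), symm_ne_symm _ _ (by norm_num)⟩
  have n4 : v13 ∉ ({v47} : Finset (HeightOneSpectrum (𝓞 ℚ))) := by
    simp only [Finset.mem_singleton, hv13, hv47]
    exact symm_ne_symm _ _ (by norm_num)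
  refine kobayashiMainConjecture_of_lambdaTransfer_of_le_at_conductor h12 h41 h5 h3 hL20 hKim hp2 hSS.1 hap
    hs ε hf₀ hcert hSS'.1 hap' he hlam' ({v2, v5, v11, v13, v47} : Finset (HeightOneSpectrum (𝓞 ℚ))) ?_ ?_ ?_ ?_
  · -- `7 ∉ v` for `v ∈ Σ₀`
    intro v hv
    simp only [Finset.mem_insert, Finset.mem_singleton] at hv
    rcases hv with rfl | rfl | rfl | rfl | rfl
    · exact natCast_not_mem_symm (by norm_num) _ (by norm_num)
    · exact natCast_not_mem_symm (by norm_num) _ (by norm_num)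
    · exact natCast_not_mem_symm (by norm_num) _ (by norm_num)
    · exact natCast_not_mem_symm (by norm_num) _ (by norm_num)
    · exact natCast_not_mem_symm (by norm_num) _ (by norm_num)
  · -- `Σ₀ ⊇` bad places of `E`: `Δ(E) = −2 ^ 8 * 5 ^ 7 * 11 * 13 ^ 7 * 47`
    intro v hv
    by_contra hvS
    apply hv
    apply hasGoodReductionAt_of_not_dvd hI
    intro hdvd
    have hΔ : (⟨0, 1, 0, -342100, 86102500⟩ : WeierstrassCurve ℤ).Δ = -(2 ^ 8 * 5 ^ 7 * 11 * 13 ^ 7 * 47) := by decide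
    rw [hΔ, dvd_neg] at hdvd
    have hpr := prime_natGenerator v
    have h' : natGenerator v ∣ 2 ^ 8 * 5 ^ 7 * 11 * 13 ^ 7 * 47 := by exact_mod_cast hdvd
    have key : natGenerator v = 2 ∨ natGenerator v = 5 ∨ natGenerator v = 11 ∨ natGenerator v = 13 ∨ natGenerator v = 47 := by
      rcases (Nat.Prime.dvd_mul hpr).mp h' with h | h
      · rcases (Nat.Prime.dvd_mul hpr).mp h with h | h
        · rcases (Nat.Prime.dvd_mul hpr).mp h with h | h
          · rcases (Nat.Prime.dvd_mul hpr).mp h with h | h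
            · exact Or.inl ((Nat.prime_dvd_prime_iff_eq hpr Nat.prime_two).mp (hpr.dvd_of_dvd_pow h))
            · exact Or.inr (Or.inl ((Nat.prime_dvd_prime_iff_eq hpr (by norm_num)).mp (hpr.dvd_of_dvd_pow h)))
          · exact Or.inr (Or.inr (Or.inl ((Nat.prime_dvd_prime_iff_eq hpr (by norm_num)).mp h)))
        · exact Or.inr (Or.inr (Or.inr (Or.inl ((Nat.prime_dvd_prime_iff_eq hpr (by norm_num)).mp (hpr.dvd_of_dvd_pow h)))))
      · exact Or.inr (Or.inr (Or.inr (Or.inr ((Nat.prime_dvd_prime_iff_eq hpr (by norm_num)).mp h))))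
    apply hvS
    simp only [Finset.mem_insert, Finset.mem_singleton]
    rcases key with h | h | h | h | h
    · exact Or.inl (eq_symm_of_natGenerator_eq Nat.prime_two h)
    · exact Or.inr (Or.inl (eq_symm_of_natGenerator_eq (by norm_num) h))
    · exact Or.inr (Or.inr (Or.inl (eq_symm_of_natGenerator_eq (by norm_num) h)))
    · exact Or.inr (Or.inr (Or.inr (Or.inl (eq_symm_of_natGenerator_eq (by norm_num) h))))
    · exact Or.inr (Or.inr (Or.inr (Or.inr (eq_symm_of_natGenerator_eq (by norm_num) h))))
  · -- `Σ₀ ⊇` bad places of `E′`: `Δ(E′) = −2 ^ 8 * 11 * 47 ^ 2`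
    intro v hv
    by_contra hvS
    apply hv
    apply hasGoodReductionAt_of_not_dvd hI'
    intro hdvd
    have hΔ : (⟨0, 1, 0, -9581, -364177⟩ : WeierstrassCurve ℤ).Δ = -(2 ^ 8 * 11 * 47 ^ 2) := by decide
    rw [hΔ, dvd_neg] at hdvd
    have hpr := prime_natGenerator v
    have h' : natGenerator v ∣ 2 ^ 8 * 11 * 47 ^ 2 := by exact_mod_cast hdvd
    have key : natGenerator v = 2 ∨ natGenerator v = 11 ∨ natGenerator v = 47 := by
      rcases (Nat.Prime.dvd_mul hpr).mp h' with h | h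
      · rcases (Nat.Prime.dvd_mul hpr).mp h with h | h
        · exact Or.inl ((Nat.prime_dvd_prime_iff_eq hpr Nat.prime_two).mp (hpr.dvd_of_dvd_pow h))
        · exact Or.inr (Or.inl ((Nat.prime_dvd_prime_iff_eq hpr (by norm_num)).mp h))
      · exact Or.inr (Or.inr ((Nat.prime_dvd_prime_iff_eq hpr (by norm_num)).mp (hpr.dvd_of_dvd_pow h)))
    apply hvS
    simp only [Finset.mem_insert, Finset.mem_singleton]
    rcases key with h | h | h
    · exact Or.inl (eq_symm_of_natGenerator_eq Nat.prime_two h)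
    · exact Or.inr (Or.inr (Or.inl (eq_symm_of_natGenerator_eq (by norm_num) h)))
    · exact Or.inr (Or.inr (Or.inr (Or.inr (eq_symm_of_natGenerator_eq (by norm_num) h))))
  · -- the books `l + (0 + 0 + 0 + 0 + 0) ≤ l′ + (0 + 1 + 0 + 1 + 0)`
    rw [Finset.sum_insert n1, Finset.sum_insert n2, Finset.sum_insert n3, Finset.sum_insert n4, Finset.sum_singleton,
      Finset.sum_insert n1, Finset.sum_insert n2, Finset.sum_insert n3, Finset.sum_insert n4, Finset.sum_singleton,
      d2, d5, d11, d13, d47, e2, e5, e11, e13, e47]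
    omega

/-! ### §3 The record: E's two-engine row displayed, the donor's rank as the partner datum -/

/-- **`congl7_134420g1_7`, sign `ε = −1` (ODD layers, the tree's `L⁺`), from the RANK-ONE DONOR `2068c1`.**
Kobayashi's main conjecture for `(134420g1, 7, ε = −1)` AT THE PAIR — a LIVE desk-RESIDUE `(7, X7)` cell (pickle `pub-bsdpct-r1-g257/scratchA_A_state_after_hyb3_x4g_v6v7_fold.pkl`;
open cells [[7, 'X7']], registers none; `r_an = 1`) with `λ(L^{−1}_7(E)) = 3`: E's two-engine ODD row (b2b iw-2 `tables/engT_layers.tsv` key `134420g1@7`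
layer `n = 1`, `q = 0 = deg ω_1^+`, `μ(θ_1) = 0`, `λ(θ_1) = 3 = 0 + 3`, engine B b2b kit j094265 = ENGINE T b2b kit j098039 `V = 3` CERTIFIED, AGREE;
displayed in this seat's rows file `…CongruenceSevenDonorRows`) as `hΘ, hΘ0, hμ, hlam`; the partner datum is ONLY the donor's `hr′ : r_an(E′) = 1` (Cremona 2068c1: rank 1) turned into `1 ≤ λ(X^ε(E′))` by (D1′) `one_le_lambdaInvariant_of_analyticRank_eq_one` (GZK `hGZK` + the tree theorem `T^{rank} ∣ ξ`);
books `3 + 0 ≤ 1 + 2`. Inputs BY NAME `h12 h41 h5 h3 hL20 hKim hF hGZK`; data binders as in `…_of_partnerBound_2068c1` plus `hr′`.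
No preprint binder («published + certificates» tier; the 7-congruence is Fisher's PUBLISHED Theorem 4.8 applied to a kernel-checked point; no period rider at `p = 7`).
PER PAIR; nothing booked; BSD is not proved by any of this.
[cite: Kobayashi2003, Conjecture (p. 2), Thm. 1.2 and Thm. 4.1] [cite: GreenbergLNM1716, §3 Lemma 3.1]
[cite: Pollack2003, Def. 6.15, Prop. 6.9, 6.10 and 6.18] [cite: BDKim2009, Cor. 2.13 (p. 187)] [cite: Fisher2014SevenElevenCongruent, Thm. 4.8] [cite: Cremona2006, Table 1 (Cremona label 134420g1)] -/
theorem congl7_kobayashiMainConjecture_134420g1_7_odd_of_rankOneDonor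
    (h12 : Kobayashi2003.thm12_signedSelmerDual_finite_torsion)
    (h41 : Kobayashi2003.thm41_signedCharIdeal_divisibility)
    (h5 : realPeriodRat_eq_unit_mul_plusPeriod) (h3 : realPeriodRat_eq_unit_mul_plusPeriod_three)
    (hL20 : Wuthrich2014.lemma20_surjective_threeAdic_of_semistable)
    (hKim : BDKim2009.cor213_signedLambda_add_sum_delta_eq_of_torsionIso)
    (hF : thm48_sevenCongruent_twistQuartic7)
    (hGZK : rank_eq_analyticRank_of_analyticRank_le_one)
    [(⟨0, 1, 0, -342100, 86102500⟩ : WeierstrassCurve ℚ).IsElliptic]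
    [(⟨0, 1, 0, -342100, 86102500⟩ : WeierstrassCurve ℚ).IsGloballyMinimal]
    [(⟨0, 1, 0, -9581, -364177⟩ : WeierstrassCurve ℚ).IsElliptic]
    [(⟨0, 1, 0, -9581, -364177⟩ : WeierstrassCurve ℚ).IsGloballyMinimal]
    [NeZero ((⟨0, 1, 0, -342100, 86102500⟩ : WeierstrassCurve ℚ).conductorNorm ℤ)]
    {f₀ : CuspForm (Gamma0 ((⟨0, 1, 0, -342100, 86102500⟩ : WeierstrassCurve ℚ).conductorNorm ℤ)) 2}
    (hf₀ : IsNewformOf (⟨0, 1, 0, -342100, 86102500⟩ : WeierstrassCurve ℚ) f₀)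
    (hr' : (⟨0, 1, 0, -9581, -364177⟩ : WeierstrassCurve ℚ).analyticRank = 1)
    {Θ : IwasawaAlgebra 7}
    (hΘ : iwasawaToPowerSeries 7 Θ =
      ((mazurTateElement f₀ 7 1).map (algebraMap ℚ ℚ_[7]) : PowerSeries ℚ_[7]))
    (hΘ0 : Θ ≠ 0) (hμ : mu Θ = 0) (hlam : lam Θ = (cyclotomicOmegaPlus 7 1).natDegree + 3) :
    KobayashiMainConjecture (⟨0, 1, 0, -342100, 86102500⟩ : WeierstrassCurve ℚ) 7 (-1) := by
  have hI : integralModelInt (⟨0, 1, 0, -342100, 86102500⟩ : WeierstrassCurve ℚ) = ⟨0, 1, 0, -342100, 86102500⟩ :=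
    integralModelInt_eq_of_map_eq _ (map_mk_int 0 1 0 (-342100) 86102500)
  have hp2 : (7 : ℕ) ≠ 2 := by decide
  have hn := natCard_point_eq_of_countPoints 0 1 0 (-342100) 86102500 7 hp2 (by decide) s4_countPoints_134420g1_7
  have hSS : GoodSS (⟨0, 1, 0, -342100, 86102500⟩ : WeierstrassCurve ℚ) 7 :=
    goodSS_of_intModel 7 hI (by decide) hn (by norm_num)
  have hap : (⟨0, 1, 0, -342100, 86102500⟩ : WeierstrassCurve ℚ).frobeniusTrace 7 = 0 := by
    rw [frobeniusTrace_eq hI hn]; norm_num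
  exact congl7_kobayashiMainConjecture_134420g1_7_of_partnerBound_2068c1 h12 h41 h5 h3 hL20 hKim hF hf₀ (-1)
    (fun L hL ↦ lam_signed_neg_one_eq_of_mazurTate' hp2 hf₀ hSS.1 hap hL (by decide) hΘ hΘ0 hμ hlam)
    (one_le_lambdaInvariant_of_analyticRank_eq_one hGZK (-1) hr')
    (by norm_num)

end Summit.BirchSwinnertonDyer.BirchSwinnertonDyer.Theorems.CongruenceRoad

end
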